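import Summits.AtomisticToContinuum.BoseEinsteinCondensation.Theorems.BECGroundStateSOSPeriodicIRBoundFsumDefs
import Summits.AtomisticToContinuum.BoseEinsteinCondensation.Theorems.BECGroundStateSOSPeriodicIRBoundFsumDCKinetic
import Summits.AtomisticToContinuum.BoseEinsteinCondensation.Theorems.BECGroundStateSOSPeriodicIRBoundFsumConePhaseUp
import Summits.AtomisticToContinuum.BoseEinsteinCondensation.Theorems.BECGroundStateSOSPeriodicIRBoundFsumConeCS
import Summits.AtomisticToContinuum.BoseEinsteinCondensation.Theorems.BECGroundStateSOSPeriodicIRBoundWFHeartGlue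
import HarnessLib

/-!
# Crux `PeriodicIRBound` (stmt-AtomisticToContinuum-3972), line `fsum-phase-pencil`, stub S3
# `stub_phaseDoubleCommutator` — part 3: the form tautology and the near-minimiser defect

The symmetrisation of the shifted form of the phase quadrature with its partner `U_k† = −U_{−k}`:

* `𝓔_w = T + P_w` in reals (`toReal_qform_eq_add`);
* **the tautology** `Q_E(U_kΨ) = (T[U_kΨ] + Re B_0(U_{−k}U_kΨ, Ψ)) + (P[U_kΨ] + potRe(U_{−k}U_kΨ, Ψ)) − 𝒟`,
  `𝒟 = Re B_w(U_{−k}U_kΨ, Ψ) − E Re⟨U_{−k}U_kΨ, Ψ⟩` (`‖U_kΨ‖² = −Re⟨U_{−k}U_kΨ, Ψ⟩`, registered by-product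
  sub-goal `stub_fsumDCTautology`), and its sum over `k, −k`: `Q(U_kΨ) + Q(U_{−k}Ψ) = 𝒦 + 𝒫 − (𝒟_1 + 𝒟_2)` with the
  kinetic double commutator `𝒦` of part 2 and the potential one `𝒫`;
* the defect of a `δ`-near-minimiser, `−𝒟 ≤ √δ √𝓔_w[U_{−k}U_kΨ]` (`WF.abs_formRe_sub_le`);
* uniform form constants `𝓔_w[U_kΨ], ‖U_kΨ‖², 𝓔_w[U_{k'}U_kΨ] ≤ K(n, L, k, k', w) · max(𝓔_w[Ψ], ‖Ψ‖²)`.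
-/

noncomputable section

open MeasureTheory Filter
open scoped ENNReal NNReal ComplexConjugate BigOperators

namespace Summit.AtomisticToContinuum.BoseEinsteinCondensation.Cruxes.PeriodicIRBound.FsumPhasePencil

open Literature.MathematicalPhysics.QuantumManyBody.BoseGas
open Summit.AtomisticToContinuum.BoseEinsteinCondensation.Cruxes.PeriodicIRBound.LinearPhFloorWagner.WF

variable {M n : ℕ} {L : ℝ}

/-! ## Splitting the form -/

section Split

variable {f : Config M → ℂ}

/-- `𝓔_w[f] = T[f] + P_w[f]` in reals, for `C¹ f` with `P_w[f] < ∞`. [folklore] -/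
theorem toReal_qform_eq_add (w : ℝ → ℝ≥0∞) (hf : ContDiff ℝ 1 f) (hP : potForm w L f ≠ ⊤) :
    (qform w L f).toReal = (qform 0 L f).toReal + (potForm w L f).toReal := by
  rw [qform_eq_lintegral_kineticDensity_add_potForm, ← qform_zero_eq, ENNReal.toReal_add (qform_zero_ne_top L hf) hP]

/-- `P_w[f] < ∞` when `𝓔_w[f] < ∞`. [folklore] -/
theorem potForm_ne_top_of_qform (w : ℝ → ℝ≥0∞) (hq : qform w L f ≠ ⊤) : potForm w L f ≠ ⊤ :=
  ne_top_of_le_ne_top hq (potForm_le_qform' w L f)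

end Split

/-! ## The form tautology for the phase quadrature -/

section Tautology

variable {w : ℝ → ℝ≥0∞}

/-- **The shifted form of `U_kΨ` through its partner `U_{−k}`** (exact): for a core `(n+1)`-body `Ψ` with
`P_w` finite on `Ψ`, `U_kΨ` and `U_{−k}U_kΨ`,
`Q_E(U_kΨ) = (T[U_kΨ] + Re B_0(U_{−k}U_kΨ, Ψ)) + (P[U_kΨ] + potRe(U_{−k}U_kΨ, Ψ)) − (Re B_w(U_{−k}U_kΨ, Ψ) − E Re⟨U_{−k}U_kΨ, Ψ⟩)`
(`‖U_kΨ‖² = −Re⟨U_{−k}U_kΨ, Ψ⟩`, `Re B_w = Re B_0 + potRe`). [folklore] -/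
theorem eform_phaseUp_eq (hw : Measurable w) (E : ℝ) (k : Fin 3 → ℤ) {Ψ : Config (n + 1) → ℂ}
    (hΨ : IsCore L Ψ) (hU : IsCore L (phaseUp L k Ψ)) (hg : IsCore L (phaseUp L (-k) (phaseUp L k Ψ)))
    (hPΨ : potForm w L Ψ ≠ ⊤) (hPU : potForm w L (phaseUp L k Ψ) ≠ ⊤)
    (hPg : potForm w L (phaseUp L (-k) (phaseUp L k Ψ)) ≠ ⊤) :
    eform w L E (phaseUp L k Ψ) =
      ((qform 0 L (phaseUp L k Ψ)).toReal + formRe 0 L (phaseUp L (-k) (phaseUp L k Ψ)) Ψ) +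
        ((potForm w L (phaseUp L k Ψ)).toReal + potRe w L (phaseUp L (-k) (phaseUp L k Ψ)) Ψ) -
        (formRe w L (phaseUp L (-k) (phaseUp L k Ψ)) Ψ - E * innerRe L (phaseUp L (-k) (phaseUp L k Ψ)) Ψ) := by
  unfold eform
  rw [toReal_qform_eq_add w hU.contDiff hPU, normSq_phaseUp_eq_neg_innerRe k hΨ.contDiff.continuous hΨ.symm,
    formRe_eq_formRe_zero_add_potRe hw hg.contDiff hΨ.contDiff hPg hPΨ]
  ring

/-- **The form tautology** `Q(U_kΨ) + Q(U_{−k}Ψ) = 𝒦 + 𝒫 − (𝒟_1 + 𝒟_2)` with the kinetic double commutator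
`𝒦 = T[U_kΨ] + T[U_{−k}Ψ] + Re B_0(U_{−k}U_kΨ, Ψ) + Re B_0(U_kU_{−k}Ψ, Ψ)`, the potential one
`𝒫 = P[U_kΨ] + P[U_{−k}Ψ] + potRe(U_{−k}U_kΨ, Ψ) + potRe(U_kU_{−k}Ψ, Ψ)` and the defects
`𝒟_i = Re B_w(g_i, Ψ) − E Re⟨g_i, Ψ⟩`, `g_1 = U_{−k}U_kΨ`, `g_2 = U_kU_{−k}Ψ`. [folklore] -/
theorem eform_add_eform_phaseUp_eq (hw : Measurable w) (E : ℝ) (k : Fin 3 → ℤ) {Ψ : Config (n + 1) → ℂ}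
    (hΨ : IsCore L Ψ) (hU : IsCore L (phaseUp L k Ψ)) (hU' : IsCore L (phaseUp L (-k) Ψ))
    (hg : IsCore L (phaseUp L (-k) (phaseUp L k Ψ))) (hg' : IsCore L (phaseUp L k (phaseUp L (-k) Ψ)))
    (hPΨ : potForm w L Ψ ≠ ⊤) (hPU : potForm w L (phaseUp L k Ψ) ≠ ⊤) (hPU' : potForm w L (phaseUp L (-k) Ψ) ≠ ⊤)
    (hPg : potForm w L (phaseUp L (-k) (phaseUp L k Ψ)) ≠ ⊤) (hPg' : potForm w L (phaseUp L k (phaseUp L (-k) Ψ)) ≠ ⊤) :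
    eform w L E (phaseUp L k Ψ) + eform w L E (phaseUp L (-k) Ψ) =
      ((qform 0 L (phaseUp L k Ψ)).toReal + (qform 0 L (phaseUp L (-k) Ψ)).toReal +
          formRe 0 L (phaseUp L (-k) (phaseUp L k Ψ)) Ψ + formRe 0 L (phaseUp L k (phaseUp L (-k) Ψ)) Ψ) +
        ((potForm w L (phaseUp L k Ψ)).toReal + (potForm w L (phaseUp L (-k) Ψ)).toReal +
          potRe w L (phaseUp L (-k) (phaseUp L k Ψ)) Ψ + potRe w L (phaseUp L k (phaseUp L (-k) Ψ)) Ψ) -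
        ((formRe w L (phaseUp L (-k) (phaseUp L k Ψ)) Ψ - E * innerRe L (phaseUp L (-k) (phaseUp L k Ψ)) Ψ) +
          (formRe w L (phaseUp L k (phaseUp L (-k) Ψ)) Ψ - E * innerRe L (phaseUp L k (phaseUp L (-k) Ψ)) Ψ)) := by
  have h1 := eform_phaseUp_eq hw E k hΨ hU hg hPΨ hPU hPg
  have h2 := eform_phaseUp_eq hw E (-k) hΨ hU' (by rw [neg_neg]; exact hg') hPΨ hPU' (by rw [neg_neg]; exact hPg')
  simp only [neg_neg] at h2
  rw [h1, h2]
  ring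

/-- **The defect of a near-minimiser**: if `𝓔_w[Ψ] ≤ E₀‖Ψ‖² + δ` (all finite, `Ψ` a core), then for every core
`g` with finite form `−(Re B_w(g, Ψ) − E₀ Re⟨g, Ψ⟩) ≤ √δ √𝓔_w[g]` (`WF.abs_formRe_sub_le`). [folklore] -/
theorem neg_defect_le (hL : 0 < L) (hw : Measurable w) {Ψ g : Config M → ℂ} (hΨ : IsCore L Ψ) (hg : IsCore L g)
    (hΨE : qform w L Ψ ≠ ⊤) (hgE : qform w L g ≠ ⊤) (hE : periodicGroundStateEnergy w M L ≠ ⊤) {δ : ℝ}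
    (hδ : 0 ≤ δ)
    (hnear : (qform w L Ψ).toReal ≤ (periodicGroundStateEnergy w M L).toReal * (normSq L Ψ).toReal + δ) :
    -(formRe w L g Ψ - (periodicGroundStateEnergy w M L).toReal * innerRe L g Ψ) ≤
      Real.sqrt δ * Real.sqrt ((qform w L g).toReal) := by
  have h := abs_formRe_sub_le_left hL hw hΨ hg hΨE hgE hE hδ hnear
  exact (neg_le_abs _).trans h

end Tautology

/-! ## Uniform form bounds for the iterated quadratures -/

section Bounds

variable {w : ℝ → ℝ≥0∞}

/-- A form constant for `U_k` at `(n, L, k, w)`: `𝓔_w[U_kΨ], ‖U_kΨ‖² ≤ K · D` whenever `𝓔_w[Ψ], ‖Ψ‖² ≤ D`,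
with `K < ∞` independent of `Ψ` and `D`. [folklore] -/
theorem exists_phaseUp_formConst (hL : 0 < L) (hw : Measurable w) (hint : (∫⁻ x : Space, w ‖x‖) ≠ ⊤) (n : ℕ)
    (k : Fin 3 → ℤ) : ∃ K : ℝ≥0∞, K ≠ ⊤ ∧ ∀ {Ψ : Config (n + 1) → ℂ}, IsCore L Ψ → ∀ {D : ℝ≥0∞},
      qform w L Ψ ≤ D → normSq L Ψ ≤ D → qform w L (phaseUp L k Ψ) ≤ K * D ∧ normSq L (phaseUp L k Ψ) ≤ K * D := by
  set K₁ : ℝ≥0∞ := (2 * ((n + 1 : ℝ≥0∞) * ((n + 1 : ℝ≥0∞) *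
      (1 + ENNReal.ofReal (‖latticeVec (2 * Real.pi / L) k‖ ^ 2 + n * (∫⁻ x : Space, w ‖x‖).toReal / L ^ 3)))) +
    2 * ((n + 1 : ℝ≥0∞) * ((n + 1 : ℝ≥0∞) *
      (1 + ENNReal.ofReal (‖latticeVec (2 * Real.pi / L) 0‖ ^ 2 + n * (∫⁻ x : Space, w ‖x‖).toReal / L ^ 3))))) with hK₁
  set K₂ : ℝ≥0∞ := 4 * ((n + 1 : ℝ≥0∞) * (n + 1 : ℝ≥0∞)) with hK₂
  have hn1 : (n + 1 : ℝ≥0∞) ≠ ⊤ := by simp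
  have hK₁t : K₁ ≠ ⊤ := by
    rw [hK₁]
    refine ENNReal.add_ne_top.2 ⟨?_, ?_⟩ <;>
      exact ENNReal.mul_ne_top ENNReal.ofNat_ne_top (ENNReal.mul_ne_top hn1 (ENNReal.mul_ne_top hn1
        (ENNReal.add_ne_top.2 ⟨ENNReal.one_ne_top, ENNReal.ofReal_ne_top⟩)))
  have hK₂t : K₂ ≠ ⊤ := ENNReal.mul_ne_top ENNReal.ofNat_ne_top (ENNReal.mul_ne_top hn1 hn1)
  refine ⟨K₁ + K₂, ENNReal.add_ne_top.2 ⟨hK₁t, hK₂t⟩, fun hΨ D hq hn => ⟨?_, ?_⟩⟩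
  · calc qform w L (phaseUp L k _) ≤ K₁ * D := qform_phaseUp_le hL hw hint k hΨ hq hn
      _ ≤ (K₁ + K₂) * D := by gcongr; exact le_self_add
  · calc normSq L (phaseUp L k _) ≤ K₂ * D := normSq_phaseUp_le hL k hΨ hn
      _ ≤ (K₁ + K₂) * D := by gcongr; exact le_add_self

/-- A form constant for the iterated quadrature `U_{k'}U_kΨ`: `𝓔_w[U_{k'}U_kΨ] ≤ K · D` whenever
`𝓔_w[Ψ], ‖Ψ‖² ≤ D`, with `K < ∞` independent of `Ψ` and `D`. [folklore] -/
theorem exists_phaseUp_phaseUp_formConst (hL : 0 < L) (hw : Measurable w) (hint : (∫⁻ x : Space, w ‖x‖) ≠ ⊤)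
    (n : ℕ) (k k' : Fin 3 → ℤ) : ∃ K : ℝ≥0∞, K ≠ ⊤ ∧ ∀ {Ψ : Config (n + 1) → ℂ}, IsCore L Ψ → ∀ {D : ℝ≥0∞},
      qform w L Ψ ≤ D → normSq L Ψ ≤ D → qform w L (phaseUp L k' (phaseUp L k Ψ)) ≤ K * D := by
  obtain ⟨K₁, hK₁, h₁⟩ := exists_phaseUp_formConst hL hw hint n k
  obtain ⟨K₂, hK₂, h₂⟩ := exists_phaseUp_formConst hL hw hint n k'
  refine ⟨K₂ * K₁, ENNReal.mul_ne_top hK₂ hK₁, fun hΨ D hq hn => ?_⟩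
  obtain ⟨hq₁, hn₁⟩ := h₁ hΨ hq hn
  calc qform w L (phaseUp L k' (phaseUp L k _)) ≤ K₂ * (K₁ * D) := (h₂ (isCore_phaseUp hL k hΨ) hq₁ hn₁).1
    _ = K₂ * K₁ * D := (mul_assoc _ _ _).symm

end Bounds

/-! ## Registered headline -/

/-- **Registered by-product sub-goal `stub_fsumDCTautology`** (line `fsum-phase-pencil`, helper of S3
`stub_phaseDoubleCommutator`): the form tautology `eform_phaseUp_eq`. [folklore] -/
theorem stub_fsumDCTautology : ∀ {n : ℕ} {L : ℝ} {w : ℝ → ℝ≥0∞}, Measurable w → ∀ (E : ℝ) (k : Fin 3 → ℤ) {Ψ : Config (n + 1) → ℂ}, IsCore L Ψ → IsCore L (phaseUp L k Ψ) → IsCore L (phaseUp L (-k) (phaseUp L k Ψ)) → potForm w L Ψ ≠ ⊤ → potForm w L (phaseUp L k Ψ) ≠ ⊤ → potForm w L (phaseUp L (-k) (phaseUp L k Ψ)) ≠ ⊤ → eform w L E (phaseUp L k Ψ) = ((qform 0 L (phaseUp L k Ψ)).toReal + formRe 0 L (phaseUp L (-k) (phaseUp L k Ψ)) Ψ) + ((potForm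 w L (phaseUp L k Ψ)).toReal + potRe w L (phaseUp L (-k) (phaseUp L k Ψ)) Ψ) - (formRe w L (phaseUp L (-k) (phaseUp L k Ψ)) Ψ - E * innerRe L (phaseUp L (-k) (phaseUp L k Ψ)) Ψ) :=
  fun hw E k _ hΨ hU hg hPΨ hPU hPg => eform_phaseUp_eq hw E k hΨ hU hg hPΨ hPU hPg

end Summit.AtomisticToContinuum.BoseEinsteinCondensation.Cruxes.PeriodicIRBound.FsumPhasePencil

end
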